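import Summits.BirchSwinnertonDyer.BirchSwinnertonDyer.Theorems.ResidualThetaTransportAtTwoSignedMuVanishingAtTwoPlusSel2
import Literature.NumberTheory.EllipticCurves.FineSelmerClassGroupCriterion
import Literature.NumberTheory.IwasawaTheory.ClassicalMuInvariant

/-!
# Sketch (crux-ideate k1 g8) — the fine half of `SignedMuSeedAtTwoPlus` is EXACTLY classical at `p = 2`

Typed statements only (no proofs here; nothing below is asserted). BSD is not proved by any of this.

* `CubicFieldOf A L` : `L` is a cubic subfield of the `2`-division field `ℚ(A[2])` (for a habitat⁺ class all three
  are conjugate: `L_W = ℚ(x(P))`, complex cubic, `2 = 𝔮³` totally (tamely) ramified).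
* `CubicMuZero L` : Iwasawa's `μ₂ = 0` for the cyclotomic `ℤ₂`-extension of `L` (tree predicate
  `IwasawaTheory.ClassicalMuVanishes`, growth form).
* `FineHalfIffCubicMu` (E1): for `A` good supersingular at `2` with `a₂ = 0` and `Δ_A < 0`, statement (A) of
  Coates–Sujatha at `(A, 2)` (`FinePlusSplit.FineMuZeroAtTwo A`, the line's own Prop) is EQUIVALENT to
  `μ₂(L_A^cyc) = 0` — both directions, no `ℚ(A[4])`, no Lim/Coates–Sujatha named fact; mechanism: the split
  permutation module `Ind_{L}^{ℚ} 𝔽₂ = 𝟙 ⊕ A[2]` (`3` odd; at `p = 2` the standard representation of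
  `GL₂(𝔽₂) ≅ S₃` IS the Steinberg), Shapiro, Tate's global Euler characteristic + Poitou–Tate over the layers `ℚ_n`,
  `2 ∤ h(ℚ_n)` and `A_n(L) ≅ X/ω_n X` (one totally ramified prime; Lang CF I–II Ch. 5 Thm 4.1), giving
  `corank_Ω Sel_str(ℚ_∞, A[2]) = rank_Ω (X(L_∞/L)/2) = #{μ-summands}`.
* `SeedForcesCubicMu` (E3): the crux implies `μ₂(L_W^cyc) = 0` for EVERY habitat⁺ class — the strength calibration
  (with Friedberg–Hoffstein realisation, informal: every complex cubic field with `2` totally ramified is an `L_W`).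
* `CubicMuAtTwoFamily` : the classical residue as a free-standing statement over cubic number fields.
-/

open WeierstrassCurve Literature.NumberTheory.EllipticCurves
open Literature.NumberTheory.EllipticCurves.Rank1Residual
open Literature.NumberTheory.IwasawaTheory
open Summit.BirchSwinnertonDyer.BirchSwinnertonDyer.Theses.ResidualThetaTransportAtTwo
open Literature.NumberTheory.EllipticCurves.Kobayashi2003

noncomputable section

namespace Summit.BirchSwinnertonDyer.BirchSwinnertonDyer.Cruxes.SignedMuSeedAtTwoPlus.CubicMuExact

/-- Statement (A) of Coates–Sujatha at `(A, 2)` — VERBATIM the Prop `FinePlusSplit.FineMuZeroAtTwo` of the registered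
line `Lines/fine_plus_split.lean` (restated because `Cruxes/…/Lines` modules are not built library modules). -/
def FineMuZeroAtTwo (A : WeierstrassCurve ℚ) [A.IsElliptic] : Prop :=
  ∀ (κ : ZpExtension ℚ 2), κ.IsCyclotomic →
    ∃ (γ : Field.absoluteGaloisGroup ℚ) (D : A.FineSelmerDualData κ γ),
      Module.Finite ℤ_[2] (RestrictScalars ℤ_[2] (IwasawaAlgebra 2) D.X)

/-- `L` is a cubic subfield of `ℚ(A[2])` (any of the three conjugate fields `ℚ(x(P))`, `P ∈ A[2] ∖ 0`). -/
def CubicFieldOf (A : WeierstrassCurve ℚ) [A.IsElliptic] (L : IntermediateField ℚ (AlgebraicClosure ℚ)) : Prop :=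
  L ≤ A.divisionField 2 ∧ Module.finrank ℚ L = 3

/-- Iwasawa's `μ₂ = 0` for the cyclotomic `ℤ₂`-extension of `L` (growth form, tree predicate). -/
def CubicMuZero (L : IntermediateField ℚ (AlgebraicClosure ℚ)) : Prop :=
  ∀ κL : ZpExtension L 2, κL.IsCyclotomic → ClassicalMuVanishes κL

/-- **(E1) the fine half is exactly classical.** For `A/ℚ` good supersingular at `2` with `a₂(A) = 0` and `Δ_A < 0`
and `L` a cubic subfield of `ℚ(A[2])`: statement (A) at `(A,2)` ⟺ `μ₂(L^cyc) = 0`. -/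
def FineHalfIffCubicMu : Prop :=
  ∀ (A : WeierstrassCurve ℚ) [A.IsElliptic] [A.IsGloballyMinimal], GoodSS A 2 → A.frobeniusTrace 2 = 0 → A.Δ < 0 →
    ∀ (L : IntermediateField ℚ (AlgebraicClosure ℚ)), CubicFieldOf A L → (FineMuZeroAtTwo A ↔ CubicMuZero L)

/-- (E1⇐), the direction the existing lines use (replaces `Lim2017.thm35_at_two_…` and the `ℚ(A[4])` door). -/
def FineHalfOfCubicMu : Prop :=
  ∀ (A : WeierstrassCurve ℚ) [A.IsElliptic] [A.IsGloballyMinimal], GoodSS A 2 → A.frobeniusTrace 2 = 0 → A.Δ < 0 →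
    ∀ (L : IntermediateField ℚ (AlgebraicClosure ℚ)), CubicFieldOf A L → CubicMuZero L → FineMuZeroAtTwo A

/-- (E1⇒), the NEW direction: finiteness of the residual fine Selmer group forces the classical `μ₂ = 0` of the cubic field. -/
def CubicMuOfFineHalf : Prop :=
  ∀ (A : WeierstrassCurve ℚ) [A.IsElliptic] [A.IsGloballyMinimal], GoodSS A 2 → A.frobeniusTrace 2 = 0 → A.Δ < 0 →
    ∀ (L : IntermediateField ℚ (AlgebraicClosure ℚ)), CubicFieldOf A L → FineMuZeroAtTwo A → CubicMuZero L

/-- **(E3) strength calibration.** The crux forces Iwasawa's `μ₂ = 0` for the cubic field of EVERY habitat⁺ class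
(`Sel₀ ⊆ Sel⁺`: `Kobayashi2003.fineSelmerInfty_le_signedSelmerInfty`; `μ(X⁺) = 0 ⇒ μ(X₀) = 0`; then (E1⇒);
`L_W = L_A` because `W[2] ≃ A[2]`). -/
def SeedForcesCubicMu : Prop :=
  SignedMuSeedAtTwoPlus →
    ∀ (W : WeierstrassCurve ℚ) [W.IsElliptic] [W.IsGloballyMinimal], ¬ W.HasCM → W.analyticRank = 0 →
      GoodSS W 2 → W.frobeniusTrace 2 = 0 → W.Δ < 0 →
      ∀ (L : IntermediateField ℚ (AlgebraicClosure ℚ)), CubicFieldOf W L → CubicMuZero L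

/-- The classical residue, free-standing: `μ₂ = 0` for every complex cubic number field in which `2` is totally
ramified (`2𝓞_L = 𝔮³`; «complex cubic» typed as: exactly one ring embedding into `ℝ`). Iwasawa's `μ`-conjecture restricted to this family; open (Ferrero–Washington covers only
abelian fields). Modulo Friedberg–Hoffstein realisation, `SignedMuSeedAtTwoPlus` implies it. -/
def CubicMuAtTwoFamily : Prop :=
  ∀ (L : IntermediateField ℚ (AlgebraicClosure ℚ)), Module.finrank ℚ L = 3 →
    (Nonempty (L →+* ℝ) ∧ Subsingleton (L →+* ℝ)) →
    (∃ 𝔮 : Ideal (NumberField.RingOfIntegers L), 𝔮.IsPrime ∧ 𝔮 ^ 3 = Ideal.span {(2 : NumberField.RingOfIntegers L)}) →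
    CubicMuZero L

/-- Sanity: (E1) is the conjunction of its two directions. -/
theorem fineHalfIffCubicMu_iff : FineHalfIffCubicMu ↔ (FineHalfOfCubicMu ∧ CubicMuOfFineHalf) := by
  constructor
  · intro h
    exact ⟨fun A _ _ hss ha hΔ L hL hμ => ((h A hss ha hΔ L hL).2 hμ),
      fun A _ _ hss ha hΔ L hL hF => ((h A hss ha hΔ L hL).1 hF)⟩
  · rintro ⟨h₁, h₂⟩ A _ _ hss ha hΔ L hL
    exact ⟨h₂ A hss ha hΔ L hL, h₁ A hss ha hΔ L hL⟩

/-- (E1⇐) discharges the line's stub 1 door-free on the habitat: `CubicMuZero L_A → FineMuZeroAtTwo A`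
is exactly what `fine_plus_split`/`fukuda_step`/`sign_dichotomy` consume (they currently route through `CubicDoor A`,
i.e. through `ℚ(A[4])` and the unproved tree fact `Lim2017.thm35_at_two_…`). -/
theorem fineMuZeroAtTwo_of_cubicMu (h : FineHalfOfCubicMu) (A : WeierstrassCurve ℚ) [A.IsElliptic]
    [A.IsGloballyMinimal] (hss : GoodSS A 2) (ha : A.frobeniusTrace 2 = 0) (hΔ : A.Δ < 0)
    (L : IntermediateField ℚ (AlgebraicClosure ℚ)) (hL : CubicFieldOf A L) (hμ : CubicMuZero L) :
    FineMuZeroAtTwo A :=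
  h A hss ha hΔ L hL hμ

end Summit.BirchSwinnertonDyer.BirchSwinnertonDyer.Cruxes.SignedMuSeedAtTwoPlus.CubicMuExact

end
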